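import Summits.QuantumFields.YangMills.Theorems.BalabanUVNodesN18HLayerDatum
import Summits.QuantumFields.BalabanUV.T4Continuum.Spine.NE5.TwoRunTorusRateCauchy

/-!
# BalabanUVNodes ∕ N18 — THE H-LAYER ACTIVITY DATUM OF ROUTE P1 ON THE RECORD'S TORUS CATALOGUE, ONE LAYER FURTHER DOWN:
# the term data (hol) + (226) in the DATA direction FROM THE (2.14)-DISPLAY — holomorphy through the corner values, (2.26)
# by the Cauchy mechanism from the Gaussian sup bound (2.15)–(2.25) uniform on the data box
# (Track A, DAG node N18 = NE5 `T4OutputRate.NE5 EA EB W κ θ C₅` :211; cluster K4 «SpineRates»; file 2 of seat pub-ymgap-dag-n18-c)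

HONEST FRAMING.  Count-neutral kernel bookkeeping (seat pub-ymgap-dag-n18-c g0, strategy s1; `--supports
stmt-QuantumFields-19676`): composition BY NAME of LANDED interfaces — file 1 of this seat
(`BalabanUVNodesN18HLayerDatum`: route P1's H-layer datum `hH` of `Spine/NE5/EnvelopeOnRecord` from TERM data (hol) + (226)
in the data direction), `Spine/NE5/TwoRunTorusRateCauchy.differentiableOn_term214_param` (the generic term (2.14) is
holomorphic in ANY complex parameter through its corner values) and `B13CauchyDecay.norm_term214_le_226` ((2.26) per term
from the (2.14)-form, separate σ∕τ-holomorphy and the Gaussian sup bound, as in `B13Lemma3TorusCauchy.h226_torus_of_cauchy`).  Every analytic letter below is a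
HYPOTHESIS: the underintegral expressions `Ψ j Z t z` of the terms AS FUNCTIONS OF THE STEP'S DATA `z ∈ Op × Hist`, their
separate holomorphy in the decoupling ∕ interpolation parameters `σ(Δ)`, `τ(Y)`, the holomorphy of their CORNER VALUES in
the data, and the Gaussian sup bound (2.15)–(2.25) UNIFORM on the data region (NODE A's estimate re-read on the class
(1.5) p. 3; NODE O's objects, instance 0∕1) are NOT supplied; NE5 is NOT IN PRINT ([Balaban1987RG1] Thm 1 p. 259) and NOT
PROVED here; NOT a node discharge; one finite four-torus programme at fixed ε; nothing continuum ∕ ℝ⁴ ∕ OS ∕ mass-gap ∕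
Clay.  0 `def`, 0 `sorry`.

THE POINT.  File 1 moved route P1's W2 wall for N18 to the (2.26)-TERM layer in the data direction: per printed term
`t = (𝐃, P)` of `H(Z)`, on an open data region `V ⊇ M.box j p`, (hol) `z ↦ T j Z t z` complex differentiable and (226)
`‖T j Z t z‖ ≤ weight L M c Z a t · e^{a₅|Z|}`.  Print proves (2.26) from the (2.14)-DISPLAY of the term ([II] p. 15):
`T = Π_Δ ∫₀¹ds(Δ)(1∕2πi)∮dσ(Δ)∕(σ(Δ)−s(Δ))² Π_Y ∫₀¹dt(Y)(1∕2πi)∮dτ(Y)∕(τ(Y)−t(Y))² Ψ(σ, τ)` (the tree's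
`B13Term214.term214 r lZ lD Ψ 0 0`), *"an analytic function of (𝐔, 𝐉) …, and of the complex parameters σ(Z), τ"*, by the
Cauchy estimate at the radii `|σ(Δ)| = e^{κ₁}`, `|τ(Y)|` of (2.18) and the Gaussian bound (2.15)–(2.25) of `Ψ`.  THIS FILE
reads that passage IN THE DATA DIRECTION: with `T j Z t z := term214 r (lZ j Z t) (lD j t) (Ψ j Z t z) 0 0`,
* (hol) on `V` follows from separate σ∕τ-holomorphy of each `Ψ j Z t z` (`z ∈ V`) on open sets `Uσ ⊇ {|σ| ≤ e^{κ₁}}`,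
  `Uτ ⊇ {|τ| ≤ |τ(Y)|}` and holomorphy ON `V` of the CORNER VALUES `z ↦ Ψ j Z t z σ τ` at admissible `(σ, τ)` — on `V` the
  term IS the finite signed double difference of corner values (`differentiableOn_term214_param`, B := the data space); no
  joint analyticity in `(z, σ, τ)` is needed;
* (226) on `V` follows from the same separate holomorphy and the GAUSSIAN SUP BOUND `‖Ψ j Z t z σ τ‖ ≤ e^{−½a|P|}·e^{a₅|Z|}`
  on the two closed polydiscs, UNIFORM IN `z ∈ V` (the Cauchy mechanism `B13CauchyDecay.norm_term214_le_226` at each `z`;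
  the ten lines of `B13Lemma3TorusCauchy.h226_torus_of_cauchy`, configuration-free and instance-generic).
* §1 `termData_of_display214` — ONE torus, ANY complex data space: (2.14)-display data on `V` ⟹ (hol) ∧ (226) on `V`,
  in the exact spelling of file 1's `hLayer_of_terms226`; `hLayer_of_display214` — ∘ file 1 §1: the activity
  `z ↦ Σ_t T Z t z` is complex differentiable on `V` and bounded by `C₃ε₁·e^{−(1−8δ)½Lκ·d_{k+1}(Z)}` there.
* §2 `hH_of_display214_record` — ON THE CARRIERS OF RECORD: the ∃V-form of the (2.14)-display data around every admissible
  box ⟹ the H-layer datum `hH` of `EnvelopeOnRecord.outputEnvelope_of_activities_record` VERBATIM (∘ file 1 §2);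
  `ne5_of_leaves_fibre_display214_record_eps` — route P1's END E1′ on the carriers of record, `T4OutputRate.NE5` BY NAME, with
  W2 := (2.14)-DISPLAY DATA IN THE DATA DIRECTION, both W2 clauses as ε₁-thresholds (∘ file 1 §3).
So route P1's W2 wall for N18 now reads, on the record: «per term, the underintegral expression of (2.14) as a function of
the step's data is separately holomorphic in σ, τ at the printed radii, its corner values are holomorphic on the data box,
and the Gaussian sup bound (2.15)–(2.25) holds uniformly on the data box» + Lemma 3's and (2.39)–(2.41)'s numbers — the SAME
layer at which the two-run END reads its pencil (`TwoRunTorusRateCauchy`, parameter `θ ∈ ℂ`) and row (D4) its seam.  For the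
block model the corner values' holomorphy in the data is `B13Core214Holomorphic.differentiableOn_core214X` (ANY complex
parameter space) under the (2.15)–(2.23) letters uniform on `V`: (2.16)–(2.17) = the operator margin, (2.20)∕(2.22) = the
history margin — NOT transported here (the letters' objects are NODE O's).

Sources: T. Bałaban, CMP **116** (1988) [Balaban1988RG2Cluster] (1.5) p. 3, (2.14)–(2.15) p. 15, (2.16)–(2.18) p. 16,
(2.26) p. 17, Lemma 3 (2.38) p. 20, (2.39)–(2.41) p. 21; CMP **109** (1987) [Balaban1987RG1] (0.24) p. 257, Thm 1 p. 259.
Nothing here is a claim about the Yang–Mills mass gap.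
-/

noncomputable section

namespace Summit.QuantumFields.YangMills.BalabanUVNodes.N18HLayerDatumCauchy

open Set Metric Finset
open Literature.MathematicalPhysics.QuantumFieldTheory.Balaban1983to89
open Literature.MathematicalPhysics.QuantumFieldTheory.Balaban1983to89.T4OutputRate
open Literature.MathematicalPhysics.QuantumFieldTheory.Balaban1983to89.T4InputCauchyRateData
open Literature.MathematicalPhysics.QuantumFieldTheory.Balaban1983to89.TreeLengthTorus (TPt TDom tsys torusTreeLen)
open Literature.MathematicalPhysics.QuantumFieldTheory.Balaban1983to89.TreeLengthTorusGeometry (TTouch)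
open Literature.MathematicalPhysics.QuantumFieldTheory.Balaban1983to89.TreeLengthTorusTransfer (tclosure)
open Literature.MathematicalPhysics.QuantumFieldTheory.Balaban1983to89.B13Lemma3TorusData (TBond)
open Literature.MathematicalPhysics.QuantumFieldTheory.Balaban1983to89.B13Lemma3TorusTerms (terms weight Z0)
open Literature.MathematicalPhysics.QuantumFieldTheory.Balaban1983to89.B13Term214 (term214 SepHolOn)
open Literature.MathematicalPhysics.QuantumFieldTheory.Balaban1983to89.B13Bound143 (invTau)
open Literature.MathematicalPhysics.QuantumFieldTheory.Balaban1983to89.B13CauchyDecay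
  (norm_term214_le_226 two_mul_invTau_eq)
open Literature.MathematicalPhysics.QuantumFieldTheory.Balaban1983to89.B12TreeDecay (kappa₀ K₀)
open Literature.MathematicalPhysics.QuantumFieldTheory.Balaban1983to89.B13Resummation (locE)
open Summit.QuantumFields.BalabanUV.T4Continuum.B13Carriers (TwoRuns)
open Summit.QuantumFields.BalabanUV.T4Continuum.Spine.NE5
open Summit.QuantumFields.BalabanUV.T4Continuum.Spine.NE5.TwoRunTorusRateCauchy (differentiableOn_term214_param)
open Summit.QuantumFields.YangMills.BalabanUVNodes.N18HLayerDatum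
  (hLayer_of_terms226 hH_of_terms226_record ne5_of_leaves_fibre_terms226_record_eps)

/-- The σ-contour discs about `[0, 1]` lie in `Uσ`: for `r ≤ e^{κ₁} − 1` the closed `r`-disc about any `s ∈ [0, 1]` is inside
the closed `e^{κ₁}`-disc about `0` (plumbing for the Cauchy device of (2.14) at the printed radius `|σ(Δ)| = e^{κ₁}`).
[cite: Balaban1988RG2Cluster, (2.14) p.15, (2.18) p.16] (elementary API) -/
theorem closedBall_segment_subset {Uσ : Set ℂ} {R r : ℝ} (hU : closedBall (0 : ℂ) R ⊆ Uσ) (hr' : r ≤ R - 1) :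
    ∀ s ∈ Set.uIcc (0 : ℝ) 1, closedBall (s : ℂ) r ⊆ Uσ := by
  intro s hs w hw
  refine hU (mem_closedBall.2 ?_)
  rw [Set.uIcc_of_le zero_le_one] at hs
  have h1 : dist w (s : ℂ) ≤ r := mem_closedBall.1 hw
  have h2 : dist (s : ℂ) 0 ≤ 1 := by
    rw [dist_zero_right, Complex.norm_real, Real.norm_eq_abs, abs_of_nonneg hs.1]
    exact hs.2
  linarith [dist_triangle w (s : ℂ) 0]

section Numerics

/-! Lemma 3's printed restrictions on the constants (verbatim file 1's) and the Cauchy-layer side conditions of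
`B13Lemma3TorusCauchy.h226_torus_of_cauchy` (`κ₁ ≥ 1`, `α₆ ≠ 0`, the open sets `Uσ ⊇ {|σ| ≤ e^{κ₁}}`, `Uτ ⊇ {|τ| ≤ |τ(Y)|}`,
the contour radius `0 < r ≤ e^{κ₁} − 1` with its τ-discs in `Uτ`). -/

variable {L Mb : ℕ} [NeZero L] [NeZero Mb] (c : B13.Consts) (hL : 8 ≤ c.L) (hLc : c.L = L) {a a₂ a₂' a₅ Aabs : ℝ}
variable (hα₆ : 0 < c.α₆) (hε₀ : 0 ≤ c.eps2) (hδ : 0 ≤ c.δ) (hδ7 : 0 ≤ 1 - 7 * c.δ) (hκ : 0 ≤ c.κ) (ha : 0 ≤ a)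
  (hR15 : c.R15) (hR16 : 18 * ((1 - 4 * c.δ) * c.κ) ≤ a / 20) (hR16' : 4 * c.κ ≤ a / 20)
  (hR17 : Real.exp (-(a / 20)) ≤ c.eps2) (h231 : 2 * (4 : ℝ) * (Mb : ℝ) ^ 4 * Real.exp (-(a / 10)) ≤ a / 20)
  (ha₂ : 0 ≤ a₂) (hκ229 : kappa₀ 64 8 + a₂ ≤ c.δ * c.κ)
  (hsm229 : c.α₆ * Real.exp a₂ * K₀ 64 8 * 64 ≤ a₂)
  (habsk : Real.exp (-(a / 20)) * 64 ≤ c.δ * c.κ)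
  (h18half : B13Step237.R18half c (K₀ 64 8 * Real.exp (Real.exp (-(a / 20)) * 64)))
  (h18 : B13Step237.R18sharp c (K₀ 64 8 * Real.exp (Real.exp (-(a / 20)) * 64)) ((c.L : ℝ) / 2))
  (ha₂' : 0 ≤ a₂') (hκ229' : kappa₀ 64 8 + a₂' ≤ c.δ * ((c.L : ℝ) / 2) * c.κ)
  (hsm229' : c.α₆ * Real.exp a₂' * K₀ 64 8 * 64 ≤ a₂')
  (hR20 : 18 * ((1 - 7 * c.δ) * ((c.L : ℝ) / 2) * c.κ) ≤ (c.κ₁ - 1) / 2)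
  (ha₅ : 0 ≤ a₅) (habs : a₅ + Real.exp (-((c.κ₁ - 1) / 2)) ≤ Aabs)
  (hAc : Aabs * 64 ≤ c.δ * ((c.L : ℝ) / 2) * c.κ)
  (hC3 : B13Step237.bracketF c (K₀ 64 8 * Real.exp (Real.exp (-(a / 20)) * 64)) / c.α₆ *
    Real.exp (Aabs * 64) ≤ c.C3act * c.ε₁)
variable (hκ₁ : 1 ≤ c.κ₁) {Uσ Uτ : Set ℂ} (hUσ : IsOpen Uσ) (hUτ : IsOpen Uτ)
  (hUexp : closedBall (0 : ℂ) (Real.exp c.κ₁) ⊆ Uσ) {r : ℝ} (hr : 0 < r) (hr' : r ≤ Real.exp c.κ₁ - 1)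
  (hsubτ : ∀ s ∈ Set.uIcc (0 : ℝ) 1, closedBall (s : ℂ) r ⊆ Uτ)

/-! ## §1 One torus, any complex data space: the term data (hol) + (226) from the (2.14)-display in the data direction -/

section OneTorus

variable {N' : ℕ} [NeZero N'] {P : Type*} [NormedAddCommGroup P] [NormedSpace ℂ P]

include hκ₁ hα₆ hUσ hUτ hUexp hr hr' hsubτ in
/-- **THE TERM DATA (hol) + (226) IN THE DATA DIRECTION FROM THE (2.14)-DISPLAY (one torus, any complex data space).**  Let
every term be the generic term (2.14), `T Z t z = term214 r (lZ Z t) (lD t) (Ψ Z t z) 0 0`, σ-parameters an enumeration of the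
blocks of `Z∖Z′₀`, τ-parameters an enumeration of `𝐃`, with its underintegral expression `Ψ Z t z` A FUNCTION OF THE DATA
`z`.  IF for every `z` in the data region `V`: `Ψ Z t z` is separately holomorphic in `σ` on `Uσ ⊇ {|σ| ≤ e^{κ₁}}` (admissible
`τ`) and in `τ` on `Uτ ⊇ {|τ| ≤ |τ(Y)|}` (admissible `σ`; the (2.18) radii `|τ(Y)| = (invTau c (d_k Y))⁻¹`, `0 < invTau ≤ ½`),
the CORNER VALUES `z ↦ Ψ Z t z σ τ` are complex differentiable on `V` at admissible `(σ, τ)`, and the GAUSSIAN SUP BOUND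
`‖Ψ Z t z σ τ‖ ≤ e^{−½a|P|}·e^{a₅|Z|}` of (2.15)–(2.25) holds on the two closed polydiscs UNIFORMLY IN `z ∈ V` — THEN on `V`:
(hol) every `z ↦ T Z t z` is complex differentiable (`TwoRunTorusRateCauchy.differentiableOn_term214_param`, the term being the
finite signed double difference of its corner values) and (226) `‖T Z t z‖ ≤ weight L M c Z a t · e^{a₅|Z|}`
(`B13CauchyDecay.norm_term214_le_226` at each `z`, as in `B13Lemma3TorusCauchy.h226_torus_of_cauchy`) — EXACTLY the inputs of
file 1's `hLayer_of_terms226`. [cite: Balaban1988RG2Cluster, (2.14)–(2.15) p.15, (2.18) p.16, (2.26) p.17] -/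
theorem termData_of_display214
    (hpos : ∀ Y : TDom 4 (L * N'), 0 < invTau c ((tsys 4 (L * N')).dj Y))
    (h2 : ∀ Y : TDom 4 (L * N'), invTau c ((tsys 4 (L * N')).dj Y) ≤ 1 / 2)
    (hUtau : ∀ Y : TDom 4 (L * N'), closedBall (0 : ℂ) ((invTau c ((tsys 4 (L * N')).dj Y))⁻¹) ⊆ Uτ)
    (lZ : TDom 4 N' → Finset (TDom 4 (L * N')) × Finset (TBond 4 Mb (L * N')) → List (TPt 4 N'))
    (hlZ : ∀ Z t, (lZ Z t).Nodup ∧ (lZ Z t).toFinset = Z.1 \ tclosure L N' (Z0 Mb t))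
    (lD : Finset (TDom 4 (L * N')) × Finset (TBond 4 Mb (L * N')) → List (TDom 4 (L * N')))
    (hlD : ∀ t, (lD t).Nodup ∧ (lD t).toFinset = t.1)
    (T : (Z : TDom 4 N') → Finset (TDom 4 (L * N')) × Finset (TBond 4 Mb (L * N')) → P → ℂ) {V : Set P}
    (Ψ : (Z : TDom 4 N') → Finset (TDom 4 (L * N')) × Finset (TBond 4 Mb (L * N')) → P →
      (TPt 4 N' → ℂ) → (TDom 4 (L * N') → ℂ) → ℂ)
    (hT : ∀ Z t, ∀ z ∈ V, T Z t z = term214 r (lZ Z t) (lD t) (Ψ Z t z) 0 0)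
    (hΨσ : ∀ Z t, ∀ z ∈ V, ∀ τ : TDom 4 (L * N') → ℂ, (∀ j, τ j ∈ Uτ) → SepHolOn Uσ (fun σ => Ψ Z t z σ τ))
    (hΨτ : ∀ Z t, ∀ z ∈ V, ∀ σ : TPt 4 N' → ℂ, (∀ j, σ j ∈ Uσ) → SepHolOn Uτ (fun τ => Ψ Z t z σ τ))
    (hpt : ∀ Z t (σ : TPt 4 N' → ℂ) (τ : TDom 4 (L * N') → ℂ), (∀ j, σ j ∈ Uσ) → (∀ j, τ j ∈ Uτ) →
      DifferentiableOn ℂ (fun z => Ψ Z t z σ τ) V)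
    (hK : ∀ Z t, ∀ z ∈ V, ∀ (σ : TPt 4 N' → ℂ) (τ : TDom 4 (L * N') → ℂ), (∀ j, ‖σ j‖ ≤ Real.exp c.κ₁) →
      (∀ Y, ‖τ Y‖ ≤ (invTau c ((tsys 4 (L * N')).dj Y))⁻¹) →
      ‖Ψ Z t z σ τ‖ ≤ Real.exp (-(a / 2 * (t.2.card : ℝ))) * Real.exp (a₅ * ((Z.1).card : ℝ))) :
    (∀ (Z : TDom 4 N'), ∀ t ∈ terms L Mb Z, DifferentiableOn ℂ (T Z t) V) ∧
      ∀ z ∈ V, ∀ (Z : TDom 4 N'), ∀ t ∈ terms L Mb Z,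
        ‖T Z t z‖ ≤ weight L Mb c Z a t * Real.exp (a₅ * ((Z.1).card : ℝ)) := by
  have hsubσ := closedBall_segment_subset hUexp hr'
  have h0σ : (0 : ℂ) ∈ Uσ := by simpa using hsubσ 0 (by simp) (mem_closedBall_self hr.le)
  have h0τ : (0 : ℂ) ∈ Uτ := by simpa using hsubτ 0 (by simp) (mem_closedBall_self hr.le)
  refine ⟨fun Z t _ => ?_, fun z hz Z t ht => ?_⟩
  · -- (hol): the term is the double difference of its corner values on `V`
    have h := differentiableOn_term214_param (B := P) hUσ hUτ hr hsubσ hsubτ (V := V) (Ψ := fun z => Ψ Z t z)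
      (fun z hz => hΨσ Z t z hz) (fun z hz => hΨτ Z t z hz) (fun σ τ hσ hτ => hpt Z t σ τ hσ hτ) (hlZ Z t).1
      (hlD t).1 (σ₀ := 0) (fun _ => h0σ) (τ₀ := 0) (fun _ => h0τ)
    exact h.congr fun z hz => hT Z t z hz
  · -- (226): the Cauchy mechanism `B13CauchyDecay.norm_term214_le_226` at the data point `z` (the ten lines of
    -- `B13Lemma3TorusCauchy.h226_torus_of_cauchy`, configuration-free and instance-generic)
    rw [hT Z t z hz]
    have h := norm_term214_le_226 (ι := TPt 4 N') (F := ℂ) c hκ₁ (fun Y : TDom 4 (L * N') => (tsys 4 (L * N')).dj Y)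
      hUσ hUτ hUexp hUtau hr hr' hsubτ (hΨσ Z t z hz) (hΨτ Z t z hz) (hK Z t z hz) (hlZ Z t).1 (hlD t).1 hpos h2
      (σ₀ := 0) (fun _ => by simp) (τ₀ := 0) (fun _ => by simp)
    have hlen : ((lZ Z t).length : ℝ) = ((Z.1 \ tclosure L N' (Z0 Mb t)).card : ℝ) := by
      rw [← List.toFinset_card_of_nodup (hlZ Z t).1, (hlZ Z t).2]
    rw [hlen, (hlD t).2] at h
    refine h.trans (le_of_eq ?_)
    simp only [weight, two_mul_invTau_eq c hα₆.ne']
    ring_nf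

include hL hLc hα₆ hε₀ hδ hδ7 hκ ha hR15 hR16 hR16' hR17 h231 ha₂ hκ229 hsm229 habsk h18half h18 ha₂' hκ229' hsm229'
  hR20 ha₅ habs hAc hC3 hκ₁ hUσ hUτ hUexp hr hr' hsubτ in
/-- **THE H-LAYER ACTIVITY DATUM FROM THE (2.14)-DISPLAY IN THE DATA DIRECTION (one torus, any complex data space)** — §1 ∘
file 1 §1: under the (2.14)-display data on `V` and Lemma 3's printed restrictions the activity `z ↦ Σ_{t ∈ terms L M Z} T Z t z`
is complex differentiable on `V` and bounded there by `C₃ε₁·e^{−(1−8δ)½Lκ·d_{k+1}(Z)}`.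
[cite: Balaban1988RG2Cluster, (2.14)–(2.15) p.15, (2.26) p.17, Lemma 3 (2.38) p.20] -/
theorem hLayer_of_display214
    (hpos : ∀ Y : TDom 4 (L * N'), 0 < invTau c ((tsys 4 (L * N')).dj Y))
    (h2 : ∀ Y : TDom 4 (L * N'), invTau c ((tsys 4 (L * N')).dj Y) ≤ 1 / 2)
    (hUtau : ∀ Y : TDom 4 (L * N'), closedBall (0 : ℂ) ((invTau c ((tsys 4 (L * N')).dj Y))⁻¹) ⊆ Uτ)
    (lZ : TDom 4 N' → Finset (TDom 4 (L * N')) × Finset (TBond 4 Mb (L * N')) → List (TPt 4 N'))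
    (hlZ : ∀ Z t, (lZ Z t).Nodup ∧ (lZ Z t).toFinset = Z.1 \ tclosure L N' (Z0 Mb t))
    (lD : Finset (TDom 4 (L * N')) × Finset (TBond 4 Mb (L * N')) → List (TDom 4 (L * N')))
    (hlD : ∀ t, (lD t).Nodup ∧ (lD t).toFinset = t.1)
    (T : (Z : TDom 4 N') → Finset (TDom 4 (L * N')) × Finset (TBond 4 Mb (L * N')) → P → ℂ) {V : Set P}
    (Ψ : (Z : TDom 4 N') → Finset (TDom 4 (L * N')) × Finset (TBond 4 Mb (L * N')) → P →
      (TPt 4 N' → ℂ) → (TDom 4 (L * N') → ℂ) → ℂ)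
    (hT : ∀ Z t, ∀ z ∈ V, T Z t z = term214 r (lZ Z t) (lD t) (Ψ Z t z) 0 0)
    (hΨσ : ∀ Z t, ∀ z ∈ V, ∀ τ : TDom 4 (L * N') → ℂ, (∀ j, τ j ∈ Uτ) → SepHolOn Uσ (fun σ => Ψ Z t z σ τ))
    (hΨτ : ∀ Z t, ∀ z ∈ V, ∀ σ : TPt 4 N' → ℂ, (∀ j, σ j ∈ Uσ) → SepHolOn Uτ (fun τ => Ψ Z t z σ τ))
    (hpt : ∀ Z t (σ : TPt 4 N' → ℂ) (τ : TDom 4 (L * N') → ℂ), (∀ j, σ j ∈ Uσ) → (∀ j, τ j ∈ Uτ) →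
      DifferentiableOn ℂ (fun z => Ψ Z t z σ τ) V)
    (hK : ∀ Z t, ∀ z ∈ V, ∀ (σ : TPt 4 N' → ℂ) (τ : TDom 4 (L * N') → ℂ), (∀ j, ‖σ j‖ ≤ Real.exp c.κ₁) →
      (∀ Y, ‖τ Y‖ ≤ (invTau c ((tsys 4 (L * N')).dj Y))⁻¹) →
      ‖Ψ Z t z σ τ‖ ≤ Real.exp (-(a / 2 * (t.2.card : ℝ))) * Real.exp (a₅ * ((Z.1).card : ℝ))) :
    (∀ Z : TDom 4 N', DifferentiableOn ℂ (fun z => ∑ t ∈ terms L Mb Z, T Z t z) V) ∧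
      ∀ z ∈ V, ∀ Z : TDom 4 N', ‖∑ t ∈ terms L Mb Z, T Z t z‖ ≤
        c.C3act * c.ε₁ * Real.exp (-((1 - 8 * c.δ) * ((c.L : ℝ) / 2) * c.κ * torusTreeLen Z.1)) := by
  obtain ⟨hhol, h226⟩ := termData_of_display214 c hα₆ hκ₁ hUσ hUτ hUexp hr hr' hsubτ hpos h2 hUtau lZ hlZ lD hlD T Ψ hT
    hΨσ hΨτ hpt hK
  exact hLayer_of_terms226 c hL hLc hα₆ hε₀ hδ hδ7 hκ ha hR15 hR16 hR16' hR17 h231 ha₂ hκ229 hsm229 habsk h18half h18 ha₂'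
    hκ229' hsm229' hR20 ha₅ habs hAc hC3 T hhol h226

end OneTorus

/-! ## §2 On the carriers of record: `hH` and route P1's END with W2 := (2.14)-display data in the data direction -/

section Record

variable {G : Type} [GaugeGroup G] (R : TwoRuns G)
variable {Op Hist : Type*} [NormedAddCommGroup Op] [NormedSpace ℂ Op] [NormedAddCommGroup Hist] [NormedSpace ℂ Hist]
  (M : StepModel R.carriers Op Hist)

/-! THE (2.14)-DISPLAY DATA ON THE RECORD, per creation scale `j` (the `j`-th torus of the record, `𝐃_j = TDom 4 (R.cubesPerDir j)`,
fine torus `TDom 4 (L·R.cubesPerDir j)`): the (2.18) radii at scale `j` (positive, `invTau ≤ ½`, their closed discs inside `Uτ`),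
the σ∕τ-enumerations `lZ j Z t` of the blocks of `Z∖Z′₀` and `lD j t` of `𝐃`, the terms `T j Z t : Op × Hist → ℂ` and their
underintegral expressions `Ψ j Z t : Op × Hist → (σ, τ) ↦ ℂ` AS FUNCTIONS OF THE STEP'S DATA; and the ∃V-form `hD` of the
display data around every admissible box: an OPEN `V ⊇ M.box j p` on which the terms ARE the (2.14)-display of `Ψ`, each
`Ψ j Z t z` (`z ∈ V`) is separately holomorphic in `σ` on `Uσ` and in `τ` on `Uτ`, the corner values are complex differentiable
on `V`, and the Gaussian sup bound (2.15)–(2.25) holds UNIFORMLY on `V`. -/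

variable
  (hpos : ∀ j, ∀ Y : TDom 4 (L * R.cubesPerDir j), 0 < invTau c ((tsys 4 (L * R.cubesPerDir j)).dj Y))
  (h2 : ∀ j, ∀ Y : TDom 4 (L * R.cubesPerDir j), invTau c ((tsys 4 (L * R.cubesPerDir j)).dj Y) ≤ 1 / 2)
  (hUtau : ∀ j, ∀ Y : TDom 4 (L * R.cubesPerDir j),
    closedBall (0 : ℂ) ((invTau c ((tsys 4 (L * R.cubesPerDir j)).dj Y))⁻¹) ⊆ Uτ)
  (lZ : (j : ℕ) → TDom 4 (R.cubesPerDir j) →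
    Finset (TDom 4 (L * R.cubesPerDir j)) × Finset (TBond 4 Mb (L * R.cubesPerDir j)) → List (TPt 4 (R.cubesPerDir j)))
  (hlZ : ∀ j Z t, (lZ j Z t).Nodup ∧ (lZ j Z t).toFinset = Z.1 \ tclosure L (R.cubesPerDir j) (Z0 Mb t))
  (lD : (j : ℕ) → Finset (TDom 4 (L * R.cubesPerDir j)) × Finset (TBond 4 Mb (L * R.cubesPerDir j)) →
    List (TDom 4 (L * R.cubesPerDir j)))
  (hlD : ∀ j t, (lD j t).Nodup ∧ (lD j t).toFinset = t.1)
  (T : (j : ℕ) → (Z : TDom 4 (R.cubesPerDir j)) →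
    Finset (TDom 4 (L * R.cubesPerDir j)) × Finset (TBond 4 Mb (L * R.cubesPerDir j)) → Op × Hist → ℂ)
  (Ψ : (j : ℕ) → (Z : TDom 4 (R.cubesPerDir j)) →
    Finset (TDom 4 (L * R.cubesPerDir j)) × Finset (TBond 4 Mb (L * R.cubesPerDir j)) → Op × Hist →
    (TPt 4 (R.cubesPerDir j) → ℂ) → (TDom 4 (L * R.cubesPerDir j) → ℂ) → ℂ)
  {W : Set (ℕ → ℝ)}
  (hD : ∀ j, ∀ g ∈ W, ∀ (U : R.carriers.BgB) (p : Op × Hist), p ∈ M.Base j g U →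
    ∃ V : Set (Op × Hist), IsOpen V ∧ M.box j p ⊆ V ∧
      (∀ Z t, ∀ z ∈ V, T j Z t z = term214 r (lZ j Z t) (lD j t) (Ψ j Z t z) 0 0) ∧
      (∀ Z t, ∀ z ∈ V, ∀ τ : TDom 4 (L * R.cubesPerDir j) → ℂ, (∀ i, τ i ∈ Uτ) →
        SepHolOn Uσ (fun σ => Ψ j Z t z σ τ)) ∧
      (∀ Z t, ∀ z ∈ V, ∀ σ : TPt 4 (R.cubesPerDir j) → ℂ, (∀ i, σ i ∈ Uσ) →
        SepHolOn Uτ (fun τ => Ψ j Z t z σ τ)) ∧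
      (∀ Z t (σ : TPt 4 (R.cubesPerDir j) → ℂ) (τ : TDom 4 (L * R.cubesPerDir j) → ℂ), (∀ i, σ i ∈ Uσ) →
        (∀ i, τ i ∈ Uτ) → DifferentiableOn ℂ (fun z => Ψ j Z t z σ τ) V) ∧
      (∀ Z t, ∀ z ∈ V, ∀ (σ : TPt 4 (R.cubesPerDir j) → ℂ) (τ : TDom 4 (L * R.cubesPerDir j) → ℂ),
        (∀ i, ‖σ i‖ ≤ Real.exp c.κ₁) → (∀ Y, ‖τ Y‖ ≤ (invTau c ((tsys 4 (L * R.cubesPerDir j)).dj Y))⁻¹) →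
        ‖Ψ j Z t z σ τ‖ ≤ Real.exp (-(a / 2 * (t.2.card : ℝ))) * Real.exp (a₅ * ((Z.1).card : ℝ))))

include hα₆ hκ₁ hUσ hUτ hUexp hr hr' hsubτ hpos h2 hUtau hlZ hlD hD

/-- **THE TERM DATA (hol) + (226) ON THE RECORD FROM THE (2.14)-DISPLAY DATA** — §1 `termData_of_display214` at each scale and base
point: the ∃V-form of (hol) + (226) around every admissible box, EXACTLY the hypothesis `hT` of file 1's
`hH_of_terms226_record` ∕ `ne5_of_leaves_fibre_terms226_record_eps`. [cite: Balaban1988RG2Cluster, (2.14)–(2.15) p.15, (2.18) p.16, (2.26) p.17] -/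
theorem termData_of_display214_record :
    ∀ j, ∀ g ∈ W, ∀ (U : R.carriers.BgB) (p : Op × Hist), p ∈ M.Base j g U →
      ∃ V : Set (Op × Hist), IsOpen V ∧ M.box j p ⊆ V ∧
        (∀ (Z : TDom 4 (R.cubesPerDir j)), ∀ t ∈ terms L Mb Z, DifferentiableOn ℂ (T j Z t) V) ∧
        (∀ z ∈ V, ∀ (Z : TDom 4 (R.cubesPerDir j)), ∀ t ∈ terms L Mb Z,
          ‖T j Z t z‖ ≤ weight L Mb c Z a t * Real.exp (a₅ * ((Z.1).card : ℝ))) := by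
  intro j g hg U p hp
  obtain ⟨V, hV, hbox, hT, hΨσ, hΨτ, hpt, hK⟩ := hD j g hg U p hp
  exact ⟨V, hV, hbox, termData_of_display214 c hα₆ hκ₁ hUσ hUτ hUexp hr hr' hsubτ (hpos j) (h2 j) (hUtau j) (lZ j)
    (hlZ j) (lD j) (hlD j) (T j) (Ψ j) hT hΨσ hΨτ hpt hK⟩

include hL hLc hε₀ hδ hδ7 hκ ha hR15 hR16 hR16' hR17 h231 ha₂ hκ229 hsm229 habsk h18half h18 ha₂' hκ229' hsm229' hR20 ha₅
  habs hAc hC3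

/-- **N18's W2 DATUM OF ROUTE P1 ON THE RECORD'S TORUS CATALOGUE FROM (2.14)-DISPLAY DATA.**  For a step model `M` over the
carriers of record `R.carriers`, the (2.14)-display data above and Lemma 3's printed restrictions on the constants give the
H-layer activity datum `hH` of `EnvelopeOnRecord.outputEnvelope_of_activities_record` VERBATIM for the activities
`act j z Z := Σ_{t ∈ terms L M Z} T j Z t z`, with `A = C₃ε₁`, `R_d = (1−8δ)½Lκ` (`termData_of_display214_record` ∘ file 1
`hH_of_terms226_record`). [cite: Balaban1988RG2Cluster, (1.5) p.3, (2.14)–(2.15) p.15, (2.16)–(2.18) p.16, (2.26) p.17, (2.38) p.20] -/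
theorem hH_of_display214_record :
    ∀ j, ∀ g ∈ W, ∀ (U : R.carriers.BgB) (p : Op × Hist), p ∈ M.Base j g U →
      ∃ V : Set (Op × Hist), IsOpen V ∧ M.box j p ⊆ V ∧
        (∀ Z : TDom 4 (R.cubesPerDir j),
          DifferentiableOn ℂ (fun z : Op × Hist => ∑ t ∈ terms L Mb Z, T j Z t z) V) ∧
        (∀ z ∈ V, ∀ Z : TDom 4 (R.cubesPerDir j), ‖∑ t ∈ terms L Mb Z, T j Z t z‖ ≤
          c.C3act * c.ε₁ * Real.exp (-((1 - 8 * c.δ) * ((c.L : ℝ) / 2) * c.κ * torusTreeLen Z.1))) :=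
  hH_of_terms226_record c hL hLc hα₆ hε₀ hδ hδ7 hκ ha hR15 hR16 hR16' hR17 h231 ha₂ hκ229 hsm229 habsk h18half h18 ha₂'
    hκ229' hsm229' hR20 ha₅ habs hAc hC3 R M T
    (termData_of_display214_record c hα₆ hκ₁ hUσ hUτ hUexp hr hr' hsubτ R M hpos h2 hUtau lZ hlZ lD hlD T Ψ hD)

-- decidability instances as BINDERS (cf. `EnvelopeOnRecord`, technical note: any consumer's instances unify)
variable [∀ j, DecidableEq (TDom 4 (R.cubesPerDir j))] [∀ j, DecidableRel (TTouch (d := 4) (N := R.cubesPerDir j))]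

/-- **ROUTE P1's END E1′ ON THE CARRIERS OF RECORD WITH W2 := (2.14)-DISPLAY DATA IN THE DATA DIRECTION, BOTH W2 CLAUSES AS
ε₁-THRESHOLDS** — file 1's `ne5_of_leaves_fibre_terms226_record_eps` with its term data `hT` MANUFACTURED from the display data
(`termData_of_display214_record`): under (2.13) as the definition of the output on the catalogue (`hrep`), the located numerals
`κ + 128·log 162 + 2 ≤ (1−8δ)½L·c.κ`, `C₃ε₁·e^{5κ+1}·K₀(64,8)·576 ≤ 1` and the sharp clause
`(e·576·K₀(64,8)²·C₃)·c_H·ε₁ < (θ′−ω)(1−ρ₀)`, every other leaf of `LeafIndex.ne5_of_leaves_fibre` displayed unchanged ⟹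
`T4OutputRate.NE5 EA EB W κ θ′ C₅` on `R.carriers`, literally.
[cite: Balaban1988RG2Cluster, (2.13) p.14, (2.14) p.15, (2.26) p.17, (2.38) p.20, (2.39)–(2.41) p.21; Balaban1987RG1, (0.24) p.257, Thm 1 p.259] -/
theorem ne5_of_leaves_fibre_display214_record_eps {κ : ℝ}
    (hrep : ∀ (X : R.carriers.Dom) (z : Op × Hist),
      M.Out X.1 z.1 z.2 X =
        locE (TTouch (d := 4) (N := R.cubesPerDir X.1)) (fun Z : (tsys 4 (R.cubesPerDir X.1)).Dom => Z.1)
          (fun Z => ∑ t ∈ terms L Mb Z, T X.1 Z t z) X.2.1)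
    (hC3nn : 0 ≤ c.C3act) (hε₁ : 0 ≤ c.ε₁) (hκ0 : 0 ≤ κ)
    (hrate : κ + 2 * (64 * Real.log 162) + 2 ≤ (1 - 8 * c.δ) * ((c.L : ℝ) / 2) * c.κ)
    (hKP : c.C3act * c.ε₁ * Real.exp (5 * κ + 1) * K₀ 64 8 * 9 * 64 ≤ 1)
    {EA : Functional R.carriers R.carriers.BgA} {EB : Functional R.carriers R.carriers.BgB}
    {EA₀ E₀ E₁ δ δ' θ θ' cH ω ρ₀ B : ℝ} {k₀ : ℕ}
    (l01 : L01 M EA W) (l02 : L02 M EB W) (l03 : L03 M EB W) (l05 : L05 EA W EA₀ κ) (l06 : L06 EB W E₀ κ)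
    (l07 : L07 M W δ θ) (l08 : L08 M W κ E₀ δ' θ) (l09aff : L09aff M W) (l09blind : L09blind M W) (l09hom : L09hom M W)
    (l09unit : L09unit M W κ E₁ cH ω) (hE₁ : 0 < E₁) (hδδ' : 0 ≤ δ + δ') (hθ : 0 ≤ θ) (hθθ' : θ ≤ θ') (hθ'1 : θ' ≤ 1)
    (hcH : 0 ≤ cH) (hω : 0 < ω) (hρ₀ : ρ₀ < 1) (l10near : (δ + δ') * θ ^ k₀ + cH * (EA₀ + E₀) / (1 - ω) ≤ ρ₀) (hB : 0 ≤ B)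
    (l10first : ∀ k < k₀, EA₀ + E₀ ≤ B * θ ^ k)
    (hS : Real.exp 1 * 9 * 64 * K₀ 64 8 ^ 2 * c.C3act * cH * c.ε₁ < (θ' - ω) * (1 - ρ₀)) :
    NE5 EA EB W κ θ'
      ((Real.exp 1 * 9 * 64 * K₀ 64 8 ^ 2 * (c.C3act * c.ε₁) / (1 - ρ₀) * (δ + δ') + B) * (θ' - ω) /
        (θ' - (ω + Real.exp 1 * 9 * 64 * K₀ 64 8 ^ 2 * (c.C3act * c.ε₁) / (1 - ρ₀) * cH))) :=
  ne5_of_leaves_fibre_terms226_record_eps c hL hLc hα₆ hε₀ hδ hδ7 hκ ha hR15 hR16 hR16' hR17 h231 ha₂ hκ229 hsm229 habsk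
    h18half h18 ha₂' hκ229' hsm229' hR20 ha₅ habs hAc hC3 R M T hrep hC3nn hε₁ hκ0 hrate hKP
    (termData_of_display214_record c hα₆ hκ₁ hUσ hUτ hUexp hr hr' hsubτ R M hpos h2 hUtau lZ hlZ lD hlD T Ψ hD)
    l01 l02 l03 l05 l06 l07 l08 l09aff l09blind l09hom l09unit hE₁ hδδ' hθ hθθ' hθ'1 hcH hω hρ₀ l10near hB l10first hS

end Record

end Numerics

end Summit.QuantumFields.YangMills.BalabanUVNodes.N18HLayerDatumCauchy

end
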